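import Mathlib
import Literature.NumberTheory.Transcendental.GammaIsoCross
import Literature.NumberTheory.Transcendental.GammaIsoAlgebraicStep
import Literature.NumberTheory.Transcendental.ZilberField
import Literature.NumberTheory.Transcendental.ZilberFieldQuasiminimal
import Literature.NumberTheory.Transcendental.GammaFieldsEcl

/-!
# Sub-goal `caseII_Lstep` of stub `stub_caseII` (line `eac-extends-core-automorphisms`,
crux stmt-Schanuel-0968 `Summit.Schanuel.Schanuel.Theses.RigidCore.AclSubsetLogFreeCore`)

**The L-step of Case II of the residue (A₀).** Write `τ = 2πi`, `Λ₀ = ℚτ`,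
`X = Λ₀ + ℚc̄` for a finite tuple `c̄ ⊆ ecl ∅`, and `N = acl (gens X)` for the relative algebraic
closure of the Γ-field `ℚ(X, exp X)`. Let `d` be an *L-type* element over `X`: `exp d ∈ N` but
`d ∉ N`, with `Λ₀ + ℚ(c̄, d)` strong. Then every core-fixed `x ∈ ecl ∅` (fixed by every
exponential-field automorphism of `ecl ∅`) which is algebraic over `gens (X ⊕ ℚd)` is already
algebraic over `gens X` (`caseII_Lstep`).

The three engines are HYPOTHESES of the statement (they are other registered stubs of the
line): hull-to-core `hH2C` (a Γ-isomorphism over the identity of `ℚ^{ab}(τ)` between strong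
tuples is realised by an automorphism `g` of `ecl ∅` with `g = id` on `fieldOf Λ₀`), the log
shifts `hLS` (Kummer: `(c̄, d) ↦ (c̄, d + m j τ)` is such a Γ-isomorphism for some `m ≥ 1` and all
`j ∈ ℤ`) and the affine kill lemma `hAK` (pure algebra: ring homomorphisms `σⱼ : R → ℂ` on a
subfield `R ⊇ L` mapping `L` into `L` with finite orbits, fixing `x`, and moving a transcendental
`y` affinely, `σⱼ y = uⱼ y + vⱼ` with infinitely many distinct `(uⱼ, vⱼ) ∈ Lˣ × L`, force `x`
algebraic over `L` as soon as it is algebraic over `L(y)`).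

Proof. (1) `acl (gens (X ⊕ ℚd)) ⊆ acl (L ∪ {d})` for the subfield `L = N`: `x₀ + q d ∈ L(d)` and
`exp x₀ · exp (q d) ∈ L` (`GammaField.exp_smul_mem_acl`), so `x` is algebraic over `L(d)`
(`GammaField.isAlgebraic_of_mem_acl_of_subset`), and `d` is transcendental over `L`.
(2) For `j ∈ ℤ` the tuple `(c̄, d + m j τ)` spans, together with `Λ₀`, the same subspace as
`(c̄, d)`, so it is strong, and `hH2C ∘ hLS` gives automorphisms `gⱼ` of `ecl ∅` with `gⱼ c̄ = c̄`,
`gⱼ τ = τ`, `gⱼ d = d + m j τ`. (3) `R = ecl ∅` is a subfield (`Khovanskii.eclSubfield`)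
containing `L` (`ecl ∅` is relatively algebraically closed, `Khovanskii.mem_ecl_of_isRoot`), `d`
(`GammaField.mem_ecl_of_exp_mem`) and `x`; `σⱼ = gⱼ|R` (`IsEIsoOn.equiv`). (4) `gⱼ` fixes the
`ℚ`-algebra `ℚ[gens X]` pointwise (its fixed set in `ecl ∅` is a `ℚ`-subalgebra containing `X`
and `exp X`), hence maps a root `a ∈ L` of `P ∈ ℚ[gens X][T]` to a root of `P`: `σⱼ L ⊆ L` with
finite orbits. (5) `σⱼ x = x`, `σⱼ d = 1 · d + m j τ` with `j ↦ m j τ` injective (`m ≠ 0`,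
`τ ≠ 0`). (6) `hAK` gives `x` algebraic over `L`, i.e. `x ∈ acl N = N`.

## References

* M. Bays, J. Kirby, *Pseudo-exponential maps, variants, and quasiminimality*, Algebra & Number
  Theory 12 (2018) 493–549: Lemma 8.3 (proof), Prop. 3.22 (log shifts by Kummer theory).
* J. Kirby, *Exponential algebraicity in exponential fields*, Bull. LMS 42 (2010): Lemma 3.3, §7.
-/

noncomputable section

-- the namespace `Summit.Schanuel.Schanuel.…` (problem = summit) trips the duplicated-namespace
-- linter on every declaration; the project lakefile disables it for the same reason.
set_option linter.dupNamespace false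

open Set
open Literature.ModelTheory.ExponentialFields Literature.ModelTheory.ExponentialFields.ExponentialRing
open Literature.NumberTheory.Transcendental Literature.NumberTheory.Transcendental.GammaField

namespace Summit.Schanuel.Schanuel.Theorems.RigidCore

namespace CaseIILstep

section Algebra

variable {F : Type*} [Field F]

/-- Algebraicity over a coefficient ring `T ↪ F` whose image is the set `T₀ ⊆ F`, in terms of
polynomials over `F` with coefficients in `T₀` (`Polynomial.lifts`). [folklore] -/
theorem isAlgebraic_iff_exists_coeff_mem {T : Type*} [CommRing T] [Algebra T F] {T₀ : Set F}
    (hsurj : ∀ x ∈ T₀, ∃ t : T, algebraMap T F t = x) (hmem : ∀ t : T, algebraMap T F t ∈ T₀)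
    (hinj : Function.Injective (algebraMap T F)) {a : F} :
    IsAlgebraic T a ↔ ∃ p : Polynomial F, p ≠ 0 ∧ (∀ n, p.coeff n ∈ T₀) ∧ p.IsRoot a := by
  constructor
  · rintro ⟨p, hp0, hpa⟩
    refine ⟨p.map (algebraMap T F), (Polynomial.map_ne_zero_iff hinj).2 hp0, fun n => ?_, ?_⟩
    · rw [Polynomial.coeff_map]; exact hmem _
    · rw [Polynomial.IsRoot.def, Polynomial.eval_map, ← Polynomial.aeval_def, hpa]
  · rintro ⟨p, hp0, hcoef, hroot⟩
    obtain ⟨q, hq⟩ : ∃ q : Polynomial T, q.map (algebraMap T F) = p := by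
      rw [← Polynomial.mem_lifts, Polynomial.lifts_iff_coeff_lifts]
      intro n
      obtain ⟨t, ht⟩ := hsurj _ (hcoef n)
      exact ⟨t, ht⟩
    refine ⟨q, ?_, ?_⟩
    · rintro rfl
      rw [Polynomial.map_zero] at hq
      exact hp0 hq.symm
    · rw [Polynomial.aeval_def, ← Polynomial.eval_map, hq]
      exact hroot.eq_zero

variable [CharZero F]

/-- Membership in `acl s` via polynomials over `F` with coefficients in `acl s`: the relative
algebraic closure `acl s` is a relatively algebraically closed `ℚ`-subalgebra
(`GammaField.exists_subalgebra_eq_acl`). [folklore] -/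
theorem mem_acl_iff_exists_coeff_mem {s : Set F} {a : F} :
    a ∈ acl s ↔ ∃ p : Polynomial F, p ≠ 0 ∧ (∀ n, p.coeff n ∈ acl s) ∧ p.IsRoot a := by
  obtain ⟨S, hS, halg⟩ := exists_subalgebra_eq_acl s
  have hmemS : ∀ y, y ∈ S ↔ y ∈ acl s := fun y => by rw [← SetLike.mem_coe, hS]
  have key : IsAlgebraic S a ↔ ∃ p : Polynomial F, p ≠ 0 ∧ (∀ n, p.coeff n ∈ acl s) ∧ p.IsRoot a :=
    isAlgebraic_iff_exists_coeff_mem (T := S) (T₀ := acl s)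
      (fun y hy => ⟨⟨y, (hmemS y).2 hy⟩, rfl⟩) (fun t => (hmemS _).1 t.2)
      (fun _ _ e => Subtype.ext e)
  refine ⟨fun ha => key.1 ?_, fun h => halg a (key.2 h)⟩
  exact isAlgebraic_algebraMap (⟨a, (hmemS a).2 ha⟩ : S)

/-- `acl s` is (the carrier of) a subfield of `F`. [folklore] -/
theorem exists_subfield_coe_eq_acl (s : Set F) : ∃ L : Subfield F, (L : Set F) = acl s :=
  ⟨{ carrier := acl s
     mul_mem' := mul_mem_acl
     one_mem' := one_mem_acl s
     add_mem' := add_mem_acl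
     zero_mem' := zero_mem_acl s
     neg_mem' := neg_mem_acl
     inv_mem' := fun _ => inv_mem_acl }, rfl⟩

/-- The `ℚ`-subalgebra generated by a subset of a subfield lies in it (as sets). [folklore] -/
theorem coe_adjoin_rat_subset_of_subset {S : Type*} [SetLike S F] [SubfieldClass S F] (K : S)
    {s : Set F} (hs : s ⊆ (K : Set F)) : ((Algebra.adjoin ℚ s : Subalgebra ℚ F) : Set F) ⊆ K := by
  intro z hz
  induction hz using Algebra.adjoin_induction with
  | mem z hz => exact hs hz
  | algebraMap q => exact SubfieldClass.ratCast_mem K q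
  | add z w _ _ hz hw => exact add_mem hz hw
  | mul z w _ _ hz hw => exact mul_mem hz hw

end Algebra

section Ecl

variable {K : Type*} [Field K] [CharZero K] [ExponentialRing K]

/-- `acl` of a subset of `ecl C` stays inside `ecl C`: the closure `ecl C` is a relatively
algebraically closed subfield (`Khovanskii.mem_ecl_of_isRoot`, Kirby 2010 §7).
[cite: Kirby2010EAEF, §7 (proof of Prop. 7.1)] -/
theorem acl_subset_ecl {s C : Set K} (h : s ⊆ ecl C) : acl s ⊆ ecl C := by
  intro a ha
  obtain ⟨p, hp0, hcoef, hroot⟩ := (isAlgebraic_iff_exists_coeff_mem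
    (T := Algebra.adjoin ℚ s) (T₀ := ((Algebra.adjoin ℚ s : Subalgebra ℚ K) : Set K))
    (fun y hy => ⟨⟨y, hy⟩, rfl⟩) (fun t => t.2) (fun _ _ e => Subtype.ext e)).1 (mem_acl_iff.1 ha)
  have hsub : ((Algebra.adjoin ℚ s : Subalgebra ℚ K) : Set K) ⊆ ecl C :=
    coe_adjoin_rat_subset_of_subset (Khovanskii.eclSubfield C) h
  exact Khovanskii.mem_ecl_of_isRoot hp0 (fun n => hsub (hcoef n)) hroot

/-- The elements of `ecl S` fixed by an E-isomorphism `g : ecl S ≅ ecl S'` form a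
`ℚ`-subalgebra of `K` (`g` is a ring homomorphism on the subfield `ecl S`, so it fixes `ℚ`).
[folklore] -/
theorem exists_subalgebra_fixedBy {g : K → K} {S S' : Set K} (hg : IsEIsoOn g (ecl S) (ecl S')) :
    ∃ A : Subalgebra ℚ K, ∀ z, z ∈ A ↔ z ∈ ecl S ∧ g z = z := by
  refine ⟨{ carrier := {z | z ∈ ecl S ∧ g z = z}
            mul_mem' := fun {u v} hu hv =>
              ⟨Khovanskii.mul_mem_ecl hu.1 hv.1, by rw [hg.map_mul hu.1 hv.1, hu.2, hv.2]⟩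
            one_mem' := ⟨Khovanskii.one_mem_ecl S, hg.map_one⟩
            add_mem' := fun {u v} hu hv =>
              ⟨Khovanskii.add_mem_ecl hu.1 hv.1, by rw [hg.map_add hu.1 hv.1, hu.2, hv.2]⟩
            zero_mem' := ⟨Khovanskii.zero_mem_ecl S, hg.map_zero⟩
            algebraMap_mem' := fun q => ⟨SubfieldClass.ratCast_mem (Khovanskii.eclSubfield S) q, ?_⟩ },
    fun z => Iff.rfl⟩
  -- `g` fixes the rationals: it is a ring isomorphism `eclSubfield S ≃+* eclSubfield S'`
  have h1 := map_ratCast hg.equiv.toRingEquiv q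
  have h2 : ((hg.equiv.toRingEquiv (q : Khovanskii.eclSubfield S) : Khovanskii.eclSubfield S') : K) =
      g (q : K) := rfl
  have h3 : ((q : Khovanskii.eclSubfield S') : K) = q := rfl
  show g (q : K) = q
  rw [← h2, h1, h3]

end Ecl

end CaseIILstep

open CaseIILstep

/-- **The L-step of Case II** (sub-goal `caseII_Lstep` of `stub_caseII`). Let `τ = 2πi`,
`X = ℚτ + ℚc̄` with `c̄ ⊆ ecl ∅`, and let `d` be an L-type element over `X` (`exp d` algebraic
over the Γ-field `ℚ(gens X)`, `d` not) with `ℚτ + ℚ(c̄, d)` strong. Granted hull-to-core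
(`hH2C`, with `g = id` on `fieldOf ℚτ`), the Kummer log shifts (`hLS`) and the affine kill lemma
(`hAK`), every `x ∈ ecl ∅` fixed by all exponential-field automorphisms of `ecl ∅` and algebraic
over `gens (X ⊕ ℚd)` is algebraic over `gens X`: the automorphisms `gⱼ` realising
`(c̄, d) ↦ (c̄, d + m j τ)` restrict to ring homomorphisms of the subfield `ecl ∅` which fix `x`,
map `L = acl (gens X)` into itself with finite orbits (they fix `ℚ[gens X]` pointwise) and move
the transcendental `d` by the infinitely many distinct translations `m j τ ∈ L`, so `hAK` makes
`x` algebraic over `L`, i.e. `x ∈ acl (gens X)`. [cite: BaysKirby2018ANT, Lemma 8.3 (proof), Prop. 3.22] -/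
theorem caseII_Lstep (hZ : IsZilberField ℂ) (τ : ℂ) (hτ : τ = 2 * ↑Real.pi * Complex.I)
    (hH2C : ∀ {N : ℕ} {c c' : Fin N → ℂ},
      IsGammaIsoTw₂ (RingEquiv.refl (fieldOf (Submodule.span ℚ ({τ} : Set ℂ)))) c c' →
      IsStrong (Submodule.span ℚ ({τ} : Set ℂ) ⊔ Submodule.span ℚ (range c)) →
      IsStrong (Submodule.span ℚ ({τ} : Set ℂ) ⊔ Submodule.span ℚ (range c')) →
      ∃ g : ℂ → ℂ, IsEIsoOn g (ecl (∅ : Set ℂ)) (ecl (∅ : Set ℂ)) ∧ (∀ j, g (c j) = c' j) ∧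
        ∀ k : fieldOf (Submodule.span ℚ ({τ} : Set ℂ)), g k = k)
    (hLS : ∀ {N : ℕ} (c : Fin N → ℂ) (d : ℂ),
      Complex.exp d ∈ acl (gens (Submodule.span ℚ ({τ} : Set ℂ) ⊔ Submodule.span ℚ (range c))) →
      d ∉ acl (gens (Submodule.span ℚ ({τ} : Set ℂ) ⊔ Submodule.span ℚ (range c))) →
      ∃ m : ℕ, 0 < m ∧ ∀ j : ℤ,
        IsGammaIsoTw₂ (RingEquiv.refl (fieldOf (Submodule.span ℚ ({τ} : Set ℂ))))
          (Fin.snoc c d) (Fin.snoc c (d + (m : ℂ) * (j : ℂ) * τ)))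
    (hAK : ∀ (L R : Subfield ℂ) (hLR : L ≤ R) (x y : ℂ) (hxR : x ∈ R) (hyR : y ∈ R),
      Transcendental L y → IsAlgebraic (IntermediateField.adjoin L ({y} : Set ℂ)) x →
      ∀ (σ : ℤ → (R →+* ℂ)),
        (∀ (j : ℤ) (a : ℂ) (ha : a ∈ L), σ j ⟨a, hLR ha⟩ ∈ L) →
        (∀ (a : ℂ) (ha : a ∈ L), Set.Finite (Set.range fun j => σ j ⟨a, hLR ha⟩)) →
        (∀ j, σ j ⟨x, hxR⟩ = x) →
        ∀ (u v : ℤ → ℂ), (∀ j, u j ∈ L ∧ u j ≠ 0) → (∀ j, v j ∈ L) →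
          (∀ j, σ j ⟨y, hyR⟩ = u j * y + v j) → (Function.Injective fun j => (u j, v j)) →
          IsAlgebraic L x)
    {N : ℕ} (c : Fin N → ℂ) (d : ℂ) (hc : ∀ i, c i ∈ ecl (∅ : Set ℂ))
    (hs : IsStrong (Submodule.span ℚ ({τ} : Set ℂ) ⊔ Submodule.span ℚ (range (Fin.snoc c d))))
    (hexp : Complex.exp d ∈ acl (gens (Submodule.span ℚ ({τ} : Set ℂ) ⊔ Submodule.span ℚ (range c))))
    (hd : d ∉ acl (gens (Submodule.span ℚ ({τ} : Set ℂ) ⊔ Submodule.span ℚ (range c)))) :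
    ∀ x ∈ ecl (∅ : Set ℂ),
      (∀ g : ℂ → ℂ, IsEIsoOn g (ecl (∅ : Set ℂ)) (ecl (∅ : Set ℂ)) → g x = x) →
      x ∈ acl (gens (Submodule.span ℚ ({τ} : Set ℂ) ⊔ Submodule.span ℚ (range (Fin.snoc c d)))) →
      x ∈ acl (gens (Submodule.span ℚ ({τ} : Set ℂ) ⊔ Submodule.span ℚ (range c))) := by
  classical
  -- Zilber's conjecture is only used through the engines `hH2C`, `hLS`; consume it.
  cases hZ
  intro x hxecl hxfix hxY
  set Λ₀ : Submodule ℚ ℂ := Submodule.span ℚ ({τ} : Set ℂ)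
  set X : Submodule ℚ ℂ := Λ₀ ⊔ Submodule.span ℚ (range c) with hXdef
  /- (0) `τ ≠ 0`, `τ ∈ ecl ∅`, `X ⊆ gens X ⊆ acl (gens X) ⊆ ecl ∅` -/
  have hτ0 : τ ≠ 0 := by
    rw [hτ]
    have hπ : (Real.pi : ℂ) ≠ 0 := Complex.ofReal_ne_zero.2 Real.pi_ne_zero
    simp [hπ, Complex.I_ne_zero]
  have hexpτ : Complex.exp τ = 1 := by rw [hτ]; exact Complex.exp_two_pi_mul_I
  have hτecl : τ ∈ ecl (∅ : Set ℂ) :=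
    expKernel_subset_ecl (∅ : Set ℂ) ((mem_expKernel_iff τ).2 hexpτ)
  have hτX : τ ∈ X := Submodule.mem_sup_left (Submodule.subset_span rfl)
  have hXacl : (X : Set ℂ) ⊆ acl (gens X) := fun y hy => subset_acl _ (mem_gens_of_mem hy)
  have hXecl : ∀ z ∈ X, z ∈ ecl (∅ : Set ℂ) := by
    have hle : X ≤ Submodule.span ℚ (ecl (∅ : Set ℂ)) :=
      sup_le (Submodule.span_le.2 (singleton_subset_iff.2 (Submodule.subset_span hτecl)))
        (Submodule.span_le.2 (range_subset_iff.2 fun i => Submodule.subset_span (hc i)))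
    intro z hz
    exact mem_span_ecl_iff.1 (hle hz)
  have hgensecl : gens X ⊆ ecl (∅ : Set ℂ) := by
    rintro z (hz | ⟨y, hy, rfl⟩)
    · exact hXecl z hz
    · exact Khovanskii.exp_mem_ecl (hXecl y hy)
  have haclecl : acl (gens X) ⊆ ecl (∅ : Set ℂ) := acl_subset_ecl hgensecl
  /- (1) the subfields `L = acl (gens X) ≤ R = ecl ∅`; `x, d ∈ R`; `d` transcendental over `L`,
    `x` algebraic over `L(d)` -/
  obtain ⟨L, hLcoe⟩ := exists_subfield_coe_eq_acl (gens X)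
  have hL : ∀ a, a ∈ L ↔ a ∈ acl (gens X) := fun a => by rw [← SetLike.mem_coe, hLcoe]
  set R : Subfield ℂ := Khovanskii.eclSubfield (∅ : Set ℂ)
  have hLR : L ≤ R := fun a ha => haclecl ((hL a).1 ha)
  have hxR : x ∈ R := hxecl
  have hdR : d ∈ R := mem_ecl_of_exp_mem (a := d) (haclecl hexp)
  have hLalg : ∀ z, IsAlgebraic L z → z ∈ acl (gens X) := by
    intro z hz
    obtain ⟨P, hP0, hcoef, hroot⟩ := (isAlgebraic_iff_exists_coeff_mem (T := L)
      (T₀ := acl (gens X)) (fun y hy => ⟨⟨y, (hL y).2 hy⟩, rfl⟩) (fun t => (hL _).1 t.2)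
      (fun _ _ e => Subtype.ext e)).1 hz
    exact mem_acl_iff_exists_coeff_mem.2 ⟨P, hP0, hcoef, hroot⟩
  have hdtr : Transcendental L d := fun halg => hd (hLalg d halg)
  have hY : Λ₀ ⊔ Submodule.span ℚ (range (Fin.snoc c d)) = X ⊔ Submodule.span ℚ {d} := by
    rw [Fin.range_snoc, Submodule.span_insert, sup_left_comm, sup_comm, hXdef]
  set T : IntermediateField L ℂ := IntermediateField.adjoin L ({d} : Set ℂ)
  have hLT : ∀ a ∈ L, a ∈ T := fun a ha => T.algebraMap_mem ⟨a, ha⟩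
  have hdT : d ∈ T := IntermediateField.subset_adjoin L _ (mem_singleton d)
  have hYT : ∀ y ∈ X ⊔ Submodule.span ℚ {d}, y ∈ T ∧ exp y ∈ T := by
    intro y hy
    obtain ⟨x₀, hx₀, z, hz, rfl⟩ := Submodule.mem_sup.1 hy
    obtain ⟨q, rfl⟩ := Submodule.mem_span_singleton.1 hz
    refine ⟨add_mem (hLT _ ((hL _).2 (hXacl hx₀))) ?_, ?_⟩
    · rw [Rat.smul_def]
      exact mul_mem (hLT _ (SubfieldClass.ratCast_mem L q)) hdT
    · rw [exp_add]
      exact mul_mem (hLT _ ((hL _).2 (subset_acl _ (exp_mem_gens hx₀))))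
        (hLT _ ((hL _).2 (exp_smul_mem_acl q hexp)))
  have hgensYT : gens (X ⊔ Submodule.span ℚ {d}) ⊆ (T : Set ℂ) := by
    rintro z (hz | ⟨y, hy, rfl⟩)
    · exact (hYT z hz).1
    · exact (hYT y hy).2
  have hxT : IsAlgebraic T x :=
    isAlgebraic_of_mem_acl_of_subset T hgensYT (by rw [← hY]; exact hxY)
  /- (2) the log-shift automorphisms `g j` -/
  obtain ⟨m, hm, hiso⟩ := hLS c d hexp hd
  have hm0 : (m : ℂ) ≠ 0 := Nat.cast_ne_zero.2 hm.ne'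
  have hmjτX : ∀ j : ℤ, (m : ℂ) * (j : ℂ) * τ ∈ X := fun j => by
    have := X.smul_of_tower_mem m (X.smul_of_tower_mem j hτX)
    rwa [zsmul_eq_mul, nsmul_eq_mul, ← mul_assoc] at this
  have hs' : ∀ j : ℤ, IsStrong (Λ₀ ⊔ Submodule.span ℚ
      (range (Fin.snoc c (d + (m : ℂ) * (j : ℂ) * τ)))) := by
    intro j
    have h1 : Λ₀ ⊔ Submodule.span ℚ (range (Fin.snoc c (d + (m : ℂ) * (j : ℂ) * τ))) =
        X ⊔ Submodule.span ℚ {d + (m : ℂ) * (j : ℂ) * τ} := by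
      rw [Fin.range_snoc, Submodule.span_insert, sup_left_comm, sup_comm, hXdef]
    have h2 : X ⊔ Submodule.span ℚ {d + (m : ℂ) * (j : ℂ) * τ} = X ⊔ Submodule.span ℚ {d} := by
      apply le_antisymm
      · refine sup_le le_sup_left ((Submodule.span_singleton_le_iff_mem _ _).2 ?_)
        exact add_mem (Submodule.mem_sup_right (Submodule.mem_span_singleton_self d))
          (Submodule.mem_sup_left (hmjτX j))
      · refine sup_le le_sup_left ((Submodule.span_singleton_le_iff_mem _ _).2 ?_)
        have h := sub_mem (Submodule.mem_sup_right (Submodule.mem_span_singleton_self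
          (d + (m : ℂ) * (j : ℂ) * τ))) (Submodule.mem_sup_left (hmjτX j) :
            (m : ℂ) * (j : ℂ) * τ ∈ X ⊔ Submodule.span ℚ {d + (m : ℂ) * (j : ℂ) * τ})
        rwa [add_sub_cancel_right] at h
    rw [h1, h2, ← hY]
    exact hs
  have hH : ∀ j : ℤ, ∃ g : ℂ → ℂ, IsEIsoOn g (ecl (∅ : Set ℂ)) (ecl (∅ : Set ℂ)) ∧
      (∀ i, g ((Fin.snoc c d : Fin (N + 1) → ℂ) i) =
        (Fin.snoc c (d + (m : ℂ) * (j : ℂ) * τ) : Fin (N + 1) → ℂ) i) ∧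
      ∀ k : fieldOf Λ₀, g k = k :=
    fun j => hH2C (hiso j) hs (hs' j)
  choose g hg hgcd hgk using hH
  have hgc : ∀ j i, g j (c i) = c i := fun j i => by
    have h := hgcd j (Fin.castSucc i)
    rwa [Fin.snoc_castSucc, Fin.snoc_castSucc] at h
  have hgd : ∀ j, g j d = d + (m : ℂ) * (j : ℂ) * τ := fun j => by
    have h := hgcd j (Fin.last N)
    rwa [Fin.snoc_last, Fin.snoc_last] at h
  have hgτ : ∀ j, g j τ = τ := fun j =>
    hgk j ⟨τ, mem_fieldOf_of_mem (Submodule.mem_span_singleton_self τ)⟩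
  /- (3) `g j` fixes the `ℚ`-algebra `ℚ[gens X]` pointwise -/
  have hfixA : ∀ j, ∀ z ∈ Algebra.adjoin ℚ (gens X), g j z = z := by
    intro j
    obtain ⟨A, hA⟩ := exists_subalgebra_fixedBy (hg j)
    have hXA : X ≤ Subalgebra.toSubmodule A :=
      sup_le (Submodule.span_le.2 (singleton_subset_iff.2 ((hA τ).2 ⟨hτecl, hgτ j⟩)))
        (Submodule.span_le.2 (range_subset_iff.2 fun i => (hA _).2 ⟨hc i, hgc j i⟩))
    have hle : Algebra.adjoin ℚ (gens X) ≤ A := by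
      refine Algebra.adjoin_le ?_
      rintro z (hz | ⟨y, hy, rfl⟩)
      · exact hXA hz
      · have hy' := (hA y).1 (hXA hy)
        exact (hA _).2 ⟨Khovanskii.exp_mem_ecl hy'.1, by rw [(hg j).map_exp hy'.1, hy'.2]⟩
    intro z hz
    exact ((hA z).1 (hle hz)).2
  have hadjecl : ((Algebra.adjoin ℚ (gens X) : Subalgebra ℚ ℂ) : Set ℂ) ⊆ ecl (∅ : Set ℂ) :=
    coe_adjoin_rat_subset_of_subset R hgensecl
  have hadjacl : ((Algebra.adjoin ℚ (gens X) : Subalgebra ℚ ℂ) : Set ℂ) ⊆ acl (gens X) :=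
    hLcoe ▸ coe_adjoin_rat_subset_of_subset L (fun z hz => (hL z).2 (subset_acl _ hz))
  /- (4) the ring homomorphisms `σ j = g j|R : R →+* ℂ` -/
  obtain ⟨σ, hσ'⟩ : ∃ σ : ℤ → (R →+* ℂ), ∀ (j : ℤ) (y : R), σ j y = g j y :=
    ⟨fun j => R.subtype.comp (hg j).equiv.toRingEquiv.toRingHom, fun _ _ => rfl⟩
  have hσ : ∀ (j : ℤ) (a : ℂ) (ha : a ∈ R), σ j ⟨a, ha⟩ = g j a := fun j a ha => hσ' j ⟨a, ha⟩
  -- every `a ∈ L` is a root of a nonzero `P ∈ ℚ[gens X][T]`, and so are all `g j a`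
  have hroots : ∀ a ∈ L, ∃ P : Polynomial ℂ, P ≠ 0 ∧ (∀ n, P.coeff n ∈ acl (gens X)) ∧
      ∀ j, P.IsRoot (g j a) := by
    intro a ha
    obtain ⟨P, hP0, hcoef, hroot⟩ := (isAlgebraic_iff_exists_coeff_mem
      (T := Algebra.adjoin ℚ (gens X)) (T₀ := ((Algebra.adjoin ℚ (gens X) : Subalgebra ℚ ℂ) : Set ℂ))
      (fun y hy => ⟨⟨y, hy⟩, rfl⟩) (fun t => t.2) (fun _ _ e => Subtype.ext e)).1
      (mem_acl_iff.1 ((hL a).1 ha))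
    refine ⟨P, hP0, fun n => hadjacl (hcoef n), fun j => ?_⟩
    obtain ⟨Q, hQ⟩ : ∃ Q : Polynomial R, Q.map R.subtype = P := by
      rw [← Polynomial.mem_lifts, Polynomial.lifts_iff_coeff_lifts]
      exact fun n => ⟨⟨P.coeff n, hadjecl (hcoef n)⟩, rfl⟩
    have haR : a ∈ R := hLR ha
    have hQσ : Q.map (σ j) = P := by
      refine Polynomial.ext fun n => ?_
      have hQn : (Q.coeff n : ℂ) = P.coeff n := by rw [← hQ, Polynomial.coeff_map]; rfl
      rw [Polynomial.coeff_map, hσ', hfixA j _ (by rw [hQn]; exact hcoef n)]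
      exact hQn
    have hQa : Q.eval ⟨a, haR⟩ = 0 := by
      have h1 : R.subtype (Q.eval ⟨a, haR⟩) = P.eval a := by
        rw [← Polynomial.eval₂_hom, ← Polynomial.eval_map, hQ]; rfl
      exact R.subtype.injective (by rw [h1, map_zero]; exact hroot.eq_zero)
    rw [← hQσ, Polynomial.IsRoot.def, Polynomial.eval_map, ← hσ j a haR, Polynomial.eval₂_hom, hQa,
      map_zero]
  /- (5) the affine kill lemma -/
  have halgL : IsAlgebraic L x := by
    refine hAK L R hLR x d hxR hdR hdtr hxT σ ?_ ?_ ?_ (fun _ => 1)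
      (fun j => (m : ℂ) * (j : ℂ) * τ) ?_ ?_ ?_ ?_
    · -- `σ j` maps `L` into `L`
      intro j a ha
      obtain ⟨P, hP0, hcoef, hProot⟩ := hroots a ha
      rw [hσ]
      exact (hL _).2 (mem_acl_iff_exists_coeff_mem.2 ⟨P, hP0, hcoef, hProot j⟩)
    · -- finite orbits
      intro a ha
      obtain ⟨P, hP0, -, hProot⟩ := hroots a ha
      refine (P.roots.toFinset.finite_toSet).subset ?_
      rintro _ ⟨j, rfl⟩
      show σ j ⟨a, hLR ha⟩ ∈ ((P.roots.toFinset : Finset ℂ) : Set ℂ)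
      rw [Finset.mem_coe, Multiset.mem_toFinset, Polynomial.mem_roots hP0, hσ]
      exact hProot j
    · -- `x` is fixed
      intro j
      rw [hσ]
      exact hxfix (g j) (hg j)
    · -- `u j = 1 ∈ Lˣ`
      exact fun _ => ⟨L.one_mem, one_ne_zero⟩
    · -- `v j = m j τ ∈ L`
      exact fun j => (hL _).2 (hXacl (hmjτX j))
    · -- `σ j d = 1 · d + m j τ`
      intro j
      show σ j ⟨d, hdR⟩ = 1 * d + (m : ℂ) * (j : ℂ) * τ
      rw [hσ, hgd, one_mul]
    · -- the translations are pairwise distinct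
      intro j₁ j₂ h
      simp only [Prod.mk.injEq, true_and] at h
      have h1 : (m : ℂ) * (j₁ : ℂ) = (m : ℂ) * (j₂ : ℂ) := mul_right_cancel₀ hτ0 h
      exact_mod_cast mul_left_cancel₀ hm0 h1
  /- (6) conclusion -/
  exact hLalg x halgL

end Summit.Schanuel.Schanuel.Theorems.RigidCore
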